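import Summits.QuantumFields.BalabanUV.Beta.TubeZeroFree
import Summits.QuantumFields.BalabanUV.Beta.WindingWords
import Summits.QuantumFields.BalabanUV.Beta.CapRouteA

/-!
# Beta / TubeZeroFreeEnds — THEOREM DB plugged into the row: the (W) leaf format by name and route A's anchor with the (Z1) binders
# replaced by VERTEX-TORI data (β sub-cell, BINDER-OWNERS row CAP-k, lineage `b2b-balaban-beta-an5`, gen 23; node BETA-an5-g23-THEOREM-DB,
# leaf 3b; journal CLAIM l.14161)

* §1 **THE (W) LEAF FORMAT**: `sliceWindingEq_of_words` — two CLOSED COMPASS WORDS with the SAME net count `k` (one along `Im z = +w i`,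
  one along `Im z = −w i`, each: nodes `−π = x 0 ≤ … ≤ x n = π`, directions `θ j` with steps `< π`, leaf facts
  `0 < Re (e^{−iθ_j} · G (insertNth i (u + i(±w i)) q))` on `[x j, x (j+1)]`, closure `θ (n−1) = θ 0 + 2πk`) ⟹ `SliceWindingEq G w i q`
  (`WindingWords.incr_eq_of_closed_word` on both lines).  This is what a (W) certificate of CERT row 9/11 must emit per reference slice.
* §2 the TUBE form of the (Z1) conclusion (`MatTubeHol.det_ne_zero_tube_of_vertexTori`) and the REAL-SHIFTED family
  `q ↦ A (q − p)`, `Im p = 0` (its (Z1) binder follows from that of `A`: `det_sub_ne_zero_of_tube`).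
* §3 **ROUTE A'S ANCHOR WITH (Z1) FROM THE VERTEX TORI**: `rowsOfOneLoopFormCode16E_routeA₂_ofVertexToriDB` = `CapRouteA.rowsOfOneLoopFormCode16E_routeA₂`
  with `hdet`, `hdet′` DISCHARGED by `MatTubeHol.det_ne_zero_of_vertexTori` from (F) + (W) for `A` and `A′` — after this, EVERY binder of
  the row except (N) `hb` (row D1) and (T) `hT` (the two-engine ball) is a statement about the 2^{d+1} VERTEX TORI or a 1-D slice:
  STRUCTURE `MatTubeHol` ×5 (automatic for character sums), (F)/(F′) `det ≠ 0` on the vertex tori (box leaves: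
  `ResolventBoxCertificate.det_ne_zero_of_boxes`), (W)/(W′) compass words, (Z2a) `hBa hBa′`, (Z2b) `hSst hSs hSt`, (A) `hA₀`, cmp `hlo`.

HONEST FRAMING.  Kernel glue; 0 binders INSTANTIATED (no box, no word, no number is supplied here); discharging `BetaPertH` would make
Bałaban's ultraviolet stability unconditional — NOT the continuum limit, NOT the Clay problem.  0 `sorry`, 0 cite tags.
-/

namespace Summit.QuantumFields.BalabanUV.Beta.TubeZeroFreeEnds

open Complex Set Matrix
open Literature.MathematicalPhysics.QuantumFieldTheory.Balaban1983to89
open B4Strip (Strip)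
open B4ContourShift (latticeKernel)
open B4TorusKernel (descend gridPt)
open Beta.AliasingTailL1 (aliasRatioL1)
open Beta.AliasingTailLattice (codeTheta code16SetE)
open Summit.QuantumFields.BalabanUV.Beta.CapRows (Rows)
open Summit.QuantumFields.BalabanUV.Beta.TubeMaximumModulus
open Summit.QuantumFields.BalabanUV.Beta.WindingIncrement
open Summit.QuantumFields.BalabanUV.Beta.WindingWords
open Summit.QuantumFields.BalabanUV.Beta.LoopIncrement
open Summit.QuantumFields.BalabanUV.Beta.CapRouteA (rowsOfOneLoopFormCode16E_routeA₂)
open scoped Real Matrix.Norms.L2Operator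

noncomputable section

variable {d : ℕ} {G : (Fin (d + 1) → ℂ) → ℂ} {w : Fin (d + 1) → ℝ}

/-! ## §1 The (W) leaf format: two closed compass words with the same net count -/

/-- a CLOSED COMPASS WORD of net count `k` for `φ` on `[−π, π]`: nodes `x 0 = −π ≤ x 1 ≤ … ≤ x n = π`, one direction `θ j` per segment
with consecutive steps `< π`, the LEAF FACTS `0 < Re (e^{−iθ_j} φ u)` on `[x j, x (j+1)]`, and the closure `θ (n−1) = θ 0 + 2πk`. [folklore] -/
structure ClosedWord (φ : ℝ → ℂ) (k : ℤ) (n : ℕ) (x θ : ℕ → ℝ) : Prop where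
  pos : 0 < n
  first : x 0 = -π
  last : x n = π
  mono : ∀ j < n, x j ≤ x (j + 1)
  step : ∀ j, j + 1 < n → |θ (j + 1) - θ j| < π
  leaf : ∀ j < n, ∀ u ∈ Icc (x j) (x (j + 1)), 0 < (exp (-(θ j * I)) * φ u).re
  closed : θ (n - 1) = θ 0 + k * (2 * π)

/-- a closed compass word of net count `k` for a continuous `φ` with `φ π = φ (−π)` gives a continuous logarithm on `[−π, π]` with
increment EXACTLY `2πk·I`. [folklore] -/
theorem ClosedWord.exists_incr {φ : ℝ → ℂ} {k : ℤ} {n : ℕ} {x θ : ℕ → ℝ} (W : ClosedWord φ k n x θ)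
    (hφ : ContinuousOn φ (Icc (-π) π)) (hper : φ π = φ (-π)) :
    ∃ L : ℝ → ℂ, IsContLog φ (-π) π L ∧ L π - L (-π) = k * (2 * π * I) := by
  have hφ' : ContinuousOn φ (Icc (x 0) (x n)) := by rw [W.first, W.last]; exact hφ
  obtain ⟨L, hL⟩ := exists_isContLog_of_word x θ W.pos W.mono hφ' W.step W.leaf
  have e := incr_eq_of_closed_word x θ W.pos W.mono hφ' W.step W.leaf (by rw [W.first, W.last, hper]) W.closed hL
  rw [W.first, W.last] at hL e
  exact ⟨L, hL, e⟩

/-- **THE (W) LEAF FORMAT**: for a tube-holomorphic `G`, a coordinate `i` and a tube parameter `q`, two closed compass words with THE SAME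
net count `k` — one for `u ↦ G (insertNth i (u + i·w i) q)`, one for `u ↦ G (insertNth i (u − i·w i) q)` — give `SliceWindingEq G w i q`.
(For the cell: per reference slice, 2 × (a few hundred sign conditions on validated enclosures) + one integer equality.) [folklore] -/
theorem sliceWindingEq_of_words (h : TubeHol G w) (i : Fin (d + 1)) {q : Fin d → ℂ}
    (hq : q ∈ Tube (fun j => w (i.succAbove j))) (hwi : 0 ≤ w i) {k : ℤ} {nP nM : ℕ} {xP θP xM θM : ℕ → ℝ}
    (WP : ClosedWord (hEdge (slice G i q) (w i)) k nP xP θP) (WM : ClosedWord (hEdge (slice G i q) (-(w i))) k nM xM θM) :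
    SliceWindingEq G w i q := by
  have hc : ∀ s : ℝ, |s| ≤ w i → ContinuousOn (hEdge (slice G i q) s) (Icc (-π) π) := fun s hs =>
    (h.continuousOn_slice i hq).comp (continuous_hLine s).continuousOn fun u _ => by
      show (((u : ℂ) + s * I)).im ∈ Icc (-(w i)) (w i); simpa using abs_le.mp hs
  have hp : ∀ s : ℝ, hEdge (slice G i q) s π = hEdge (slice G i q) s (-π) := fun s => by
    simp only [hEdge_apply]
    rw [← h.slice_periodic i q (((-π : ℝ) : ℂ) + s * I)]
    congr 1; push_cast; ring
  obtain ⟨Lp, hLp, ep⟩ := WP.exists_incr (hc (w i) (by rw [abs_of_nonneg hwi])) (hp (w i))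
  obtain ⟨Lm, hLm, em⟩ := WM.exists_incr (hc (-(w i)) (by rw [abs_neg, abs_of_nonneg hwi])) (hp (-(w i)))
  exact ⟨Lp, Lm, hLp, hLm, by rw [ep, em]⟩

/-! ## §2 Tube form and real shifts -/

/-- the (Z1) conclusion on the whole closed TUBE (all real parts) for a matrix family. [folklore] -/
theorem MatTubeHol.det_ne_zero_tube_of_vertexTori {n : Type*} [Fintype n] [DecidableEq n]
    {A : (Fin (d + 1) → ℂ) → Matrix n n ℂ} {a : ℝ} (hA : MatTubeHol A (fun _ => a)) (ha : 0 < a)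
    (hF : ∀ p ∈ VertexTori (fun _ : Fin (d + 1) => a), (A p).det ≠ 0)
    (hW : ∀ (i : Fin (d + 1)) (s : Fin d → ℝ), (∀ j, s j = 1 ∨ s j = -1) →
      ∃ q₀ : Fin d → ℂ, (∀ j, (q₀ j).im = s j * a) ∧ SliceWindingEq (fun p => (A p).det) (fun _ => a) i q₀) :
    ∀ p ∈ Tube (fun _ : Fin (d + 1) => a), (A p).det ≠ 0 :=
  hA.det.ne_zero_of_vertexTori (fun _ => ha) hF hW

/-- THE REAL-SHIFTED FAMILY `q ↦ A (q − p)` (`Im p_μ = 0`; the cell's `k₀(q − p)` at a real source momentum): its (Z1) binder on the period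
cell follows from the tube form for `A` — no second certificate. [folklore] -/
theorem det_sub_ne_zero_of_tube {n : Type*} [Fintype n] [DecidableEq n] {A : (Fin (d + 1) → ℂ) → Matrix n n ℂ} {a : ℝ}
    (hT : ∀ q ∈ Tube (fun _ : Fin (d + 1) => a), (A q).det ≠ 0) {p : Fin (d + 1) → ℂ} (hp : ∀ μ, (p μ).im = 0) :
    ∀ q ∈ Strip (d + 1) a, (A (q - p)).det ≠ 0 := fun q hq =>
  hT (q - p) fun μ => by rw [Pi.sub_apply, sub_im, hp μ, sub_zero]; exact (hq μ).2

/-! ## §3 Route A's anchor with the (Z1) binders from vertex-tori data -/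

section RouteA

variable {b : ℕ → ℝ} {n : Type*} [Fintype n] [DecidableEq n]
variable {A A' B C D : (Fin 4 → ℂ) → Matrix n n ℂ} {a κ Ba Ba' Sst Ss St : ℝ}

/-- **ROUTE A'S ONE-LOOP-FORM ANCHOR WITH (Z1) FROM THE VERTEX TORI** — `CapRouteA.rowsOfOneLoopFormCode16E_routeA₂` with the two
8-real-dimensional binders `hdet hdet′ : ∀ p ∈ Strip 4 a, det ≠ 0` REPLACED by vertex-tori data: (F) `det ≠ 0` on the 16 vertex tori
`|Im q_μ| = a` and (W) one `SliceWindingEq` per coordinate and sign pattern, for `A` and for `A′`.  Remaining binders: (N) `hb` (row D1),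
STRUCTURE `MatTubeHol` ×5, (Z2a) `hBa hBa′` + (Z2b) `hSst hSs hSt` on `VertexTori κ`, (T) `hT`, (A) `hA₀`, cmp `hlo`. [folklore] -/
def rowsOfOneLoopFormCode16E_routeA₂_ofVertexToriDB
    (hb : b 0 = (latticeKernel (fun p => ((A p)⁻¹ * B p).trace - ((A p)⁻¹ * C p * (A' p)⁻¹ * D p).trace) 0).re)
    (hκ : 0 < κ) (hκa : κ ≤ a) (hA : MatTubeHol A (fun _ => a)) (hA' : MatTubeHol A' (fun _ => a))
    (hBst : MatTubeHol B (fun _ => a)) (hBs : MatTubeHol C (fun _ => a)) (hBt : MatTubeHol D (fun _ => a))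
    (hF : ∀ p ∈ VertexTori (fun _ : Fin (3 + 1) => a), (A p).det ≠ 0)
    (hW : ∀ (i : Fin (3 + 1)) (s : Fin 3 → ℝ), (∀ j, s j = 1 ∨ s j = -1) →
      ∃ q₀ : Fin 3 → ℂ, (∀ j, (q₀ j).im = s j * a) ∧ SliceWindingEq (fun p => (A p).det) (fun _ => a) i q₀)
    (hF' : ∀ p ∈ VertexTori (fun _ : Fin (3 + 1) => a), (A' p).det ≠ 0)
    (hW' : ∀ (i : Fin (3 + 1)) (s : Fin 3 → ℝ), (∀ j, s j = 1 ∨ s j = -1) →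
      ∃ q₀ : Fin 3 → ℂ, (∀ j, (q₀ j).im = s j * a) ∧ SliceWindingEq (fun p => (A' p).det) (fun _ => a) i q₀)
    (hBa : ∀ p ∈ VertexTori (fun _ : Fin (3 + 1) => κ), ‖(A p)⁻¹‖ ≤ Ba)
    (hBa' : ∀ p ∈ VertexTori (fun _ : Fin (3 + 1) => κ), ‖(A' p)⁻¹‖ ≤ Ba')
    (hSst : ∀ p ∈ VertexTori (fun _ : Fin (3 + 1) => κ), ‖B p‖ ≤ Sst)
    (hSs : ∀ p ∈ VertexTori (fun _ : Fin (3 + 1) => κ), ‖C p‖ ≤ Ss)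
    (hSt : ∀ p ∈ VertexTori (fun _ : Fin (3 + 1) => κ), ‖D p‖ ≤ St)
    {N : ℕ} (hN : 1 ≤ N) [NeZero (4 * N)] {t r : ℝ}
    (hT : ‖((code16SetE N).card : ℂ)⁻¹ *
        (∑ w ∈ code16SetE N, descend (fun p => ((A p)⁻¹ * B p).trace - ((A p)⁻¹ * C p * (A' p)⁻¹ * D p).trace)
          (gridPt (4 * N) w)) - t‖ ≤ r)
    {A₀ : ℝ} (hA₀ : Fintype.card n * (Ba * Sst + Ba * Ss * Ba' * St) * codeTheta (aliasRatioL1 κ N) ≤ A₀) (lo : ℚ)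
    (hlo : ((lo : ℚ) : ℝ) ≤ t - r - A₀) : Rows b :=
  rowsOfOneLoopFormCode16E_routeA₂ hb hκ hκa hA hA' hBst hBs hBt
    (hA.det_ne_zero_of_vertexTori (lt_of_lt_of_le hκ hκa) hF hW)
    (hA'.det_ne_zero_of_vertexTori (lt_of_lt_of_le hκ hκa) hF' hW') hBa hBa' hSst hSs hSt hN hT hA₀ lo hlo

/-- its level is `k₀ = 0` and its row value is `lo` (definitionally those of `rowsOfOneLoopFormCode16E_routeA₂`). [folklore] -/
theorem rowsOfOneLoopFormCode16E_routeA₂_ofVertexToriDB_k₀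
    (hb : b 0 = (latticeKernel (fun p => ((A p)⁻¹ * B p).trace - ((A p)⁻¹ * C p * (A' p)⁻¹ * D p).trace) 0).re)
    (hκ : 0 < κ) (hκa : κ ≤ a) (hA : MatTubeHol A (fun _ => a)) (hA' : MatTubeHol A' (fun _ => a))
    (hBst : MatTubeHol B (fun _ => a)) (hBs : MatTubeHol C (fun _ => a)) (hBt : MatTubeHol D (fun _ => a))
    (hF : ∀ p ∈ VertexTori (fun _ : Fin (3 + 1) => a), (A p).det ≠ 0)
    (hW : ∀ (i : Fin (3 + 1)) (s : Fin 3 → ℝ), (∀ j, s j = 1 ∨ s j = -1) →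
      ∃ q₀ : Fin 3 → ℂ, (∀ j, (q₀ j).im = s j * a) ∧ SliceWindingEq (fun p => (A p).det) (fun _ => a) i q₀)
    (hF' : ∀ p ∈ VertexTori (fun _ : Fin (3 + 1) => a), (A' p).det ≠ 0)
    (hW' : ∀ (i : Fin (3 + 1)) (s : Fin 3 → ℝ), (∀ j, s j = 1 ∨ s j = -1) →
      ∃ q₀ : Fin 3 → ℂ, (∀ j, (q₀ j).im = s j * a) ∧ SliceWindingEq (fun p => (A' p).det) (fun _ => a) i q₀)
    (hBa : ∀ p ∈ VertexTori (fun _ : Fin (3 + 1) => κ), ‖(A p)⁻¹‖ ≤ Ba)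
    (hBa' : ∀ p ∈ VertexTori (fun _ : Fin (3 + 1) => κ), ‖(A' p)⁻¹‖ ≤ Ba')
    (hSst : ∀ p ∈ VertexTori (fun _ : Fin (3 + 1) => κ), ‖B p‖ ≤ Sst)
    (hSs : ∀ p ∈ VertexTori (fun _ : Fin (3 + 1) => κ), ‖C p‖ ≤ Ss)
    (hSt : ∀ p ∈ VertexTori (fun _ : Fin (3 + 1) => κ), ‖D p‖ ≤ St)
    {N : ℕ} (hN : 1 ≤ N) [NeZero (4 * N)] {t r : ℝ}
    (hT : ‖((code16SetE N).card : ℂ)⁻¹ *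
        (∑ w ∈ code16SetE N, descend (fun p => ((A p)⁻¹ * B p).trace - ((A p)⁻¹ * C p * (A' p)⁻¹ * D p).trace)
          (gridPt (4 * N) w)) - t‖ ≤ r)
    {A₀ : ℝ} (hA₀ : Fintype.card n * (Ba * Sst + Ba * Ss * Ba' * St) * codeTheta (aliasRatioL1 κ N) ≤ A₀) (lo : ℚ)
    (hlo : ((lo : ℚ) : ℝ) ≤ t - r - A₀) :
    rowsOfOneLoopFormCode16E_routeA₂_ofVertexToriDB hb hκ hκa hA hA' hBst hBs hBt hF hW hF' hW' hBa hBa' hSst hSs hSt hN hT hA₀ lo hlo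
      = rowsOfOneLoopFormCode16E_routeA₂ hb hκ hκa hA hA' hBst hBs hBt
          (hA.det_ne_zero_of_vertexTori (lt_of_lt_of_le hκ hκa) hF hW)
          (hA'.det_ne_zero_of_vertexTori (lt_of_lt_of_le hκ hκa) hF' hW') hBa hBa' hSst hSs hSt hN hT hA₀ lo hlo :=
  rfl

end RouteA

end

end Summit.QuantumFields.BalabanUV.Beta.TubeZeroFreeEnds
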